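import Mathlib
import HarnessLib
import Summits.Ventures.LatticeQCDFlow.Scoring.DeltaMethod

/-!
# The MULTIVARIATE DELTA METHOD: `aₙ • (Xₙ − θ) ⇒ Z` in a normed space `E`, `aₙ → ∞`, `g : E → F`
# Fréchet-differentiable at `θ` with derivative `L` ⇒ `aₙ • (g(Xₙ) − g(θ)) ⇒ L Z`

HONEST FRAMING: exact (Metropolis-corrected) sampling algorithms for lattice gauge theory;
figures of merit are autocorrelation/cost numbers at stated couplings and volumes; no
continuum-physics claim.

Venture `LatticeQCDFlow` (cell pub-lqcd), topic `Scoring`; FANOUT row 4 (`s0-u1-b`, rung S0-B).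
`Scoring/DeltaMethod` proved the one-dimensional delta method and left the multivariate one NOT
CLAIMED for want of a multivariate central limit theorem; `Scoring/MultivariateCLT` now supplies
the joint Gaussian limit of a vector of printed columns, and every derived column of the card —
a self-normalised estimate (ratio of two means), `−log` of an acceptance, a free-energy
difference — is a smooth function of that vector.  This file proves the multivariate delta
method for statistics with values in a (second-countable) real normed space `E` and a map
`g : E → F` into another, differentiable at the centring `θ` in the sense of Mathlib's
`HasFDerivAt g L θ`: **`tendstoInDistribution_deltaMethod_fderiv`**.  The one-dimensional
difference-quotient trick is replaced by the exact decomposition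
`aₙ•(g Xₙ − g θ) = L(aₙ•(Xₙ − θ)) + Rₙ` with `‖Rₙ‖ = ε(Xₙ)·‖aₙ•(Xₙ − θ)‖`, where
`ε(x) = ‖x − θ‖⁻¹‖g x − g θ − L(x − θ)‖ → 0` as `x → θ` IS the definition of the Fréchet
derivative (`hasFDerivAt_iff_tendsto`); `ε(Xₙ) → 0` in probability because `Xₙ → θ` in
probability (**`tendstoInMeasure_of_tendstoInDistribution_smul`**) and `ε` is continuous at
`θ` (**`tendstoInMeasure_comp_continuousAt_normed`**); Slutsky makes `ε(Xₙ)‖aₙ•(Xₙ − θ)‖ ⇒ 0`,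
hence `Rₙ → 0` in probability, and `L(aₙ•(Xₙ − θ)) ⇒ L Z` by continuous mapping.  The
vector-valued "`⇒` a constant means `→` in probability" lemma
(**`tendstoInMeasure_of_tendstoInDistribution_const_normed`**) is included.  Printed
counterparts NAMED ONLY: van der Vaart (1998) Thm 3.1.  NEW WORK of the cell; no definition;
nothing cited as a fact.

## Content

* `tendstoInMeasure_of_tendstoInDistribution_const_normed`,
  `tendstoInMeasure_of_tendstoInDistribution_smul`, `tendstoInMeasure_comp_continuousAt_normed`;
* `tendsto_fderivRemainderRatio`, `norm_smul_fderivRemainder_eq`;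
* **`tendstoInDistribution_deltaMethod_fderiv`** — THE MULTIVARIATE DELTA METHOD.

NOT CLAIMED: second-order expansions at degenerate points (`L = 0`); random centrings;
functions differentiable only on a set of full limit measure.
-/

noncomputable section

namespace Summit.Ventures.LatticeQCDFlow.Scoring.CardConsistency

open MeasureTheory ProbabilityTheory Filter
open scoped Topology

/-! ## §1 Tools in normed spaces -/

section Tools

variable {Ω : Type*} [MeasurableSpace Ω] {P : Measure Ω} [IsProbabilityMeasure P]
variable {Ω' : Type*} [MeasurableSpace Ω'] {P' : Measure Ω'} [IsProbabilityMeasure P']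
variable {E : Type*} [NormedAddCommGroup E] [MeasurableSpace E] [BorelSpace E]

/-- **Convergence in distribution to a constant is convergence in probability** (statistics
with values in a normed group): `Xₙ ⇒ δ_c` ⇒ `Xₙ → c` in probability. [ours] (portmanteau on
the closed set `{ε ≤ ‖z − c‖}`) -/
theorem tendstoInMeasure_of_tendstoInDistribution_const_normed {X : ℕ → Ω → E} {c : E}
    (h : TendstoInDistribution X atTop (fun _ : Ω' => c) (fun _ => P) P') :
    TendstoInMeasure P X atTop (fun _ => c) := by
  rw [tendstoInMeasure_iff_norm]
  intro ε hε
  have hF : IsClosed {z : E | ε ≤ ‖z - c‖} :=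
    isClosed_le continuous_const (continuous_id.sub continuous_const).norm
  have hlim : limsup (fun n => (P.map (X n)) {z : E | ε ≤ ‖z - c‖}) atTop
      ≤ (P'.map fun _ : Ω' => c) {z : E | ε ≤ ‖z - c‖} :=
    ProbabilityMeasure.limsup_measure_closed_le_of_tendsto h.tendsto hF
  have h0 : (P'.map fun _ : Ω' => c) {z : E | ε ≤ ‖z - c‖} = 0 := by
    rw [Measure.map_apply measurable_const hF.measurableSet]
    have he : (fun _ : Ω' => c) ⁻¹' {z : E | ε ≤ ‖z - c‖} = ∅ := by
      ext ω
      simp only [Set.mem_preimage, Set.mem_setOf_eq, sub_self, norm_zero, Set.mem_empty_iff_false,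
        iff_false, not_le]
      exact hε
    rw [he, measure_empty]
  rw [h0] at hlim
  have e : (fun n => P {x | ε ≤ ‖X n x - c‖}) = fun n => (P.map (X n)) {z : E | ε ≤ ‖z - c‖} :=
    funext fun n => (Measure.map_apply_of_aemeasurable (h.forall_aemeasurable n)
      hF.measurableSet).symm
  rw [e]
  exact tendsto_of_le_liminf_of_limsup_le bot_le hlim

omit [IsProbabilityMeasure P] [MeasurableSpace E] [BorelSpace E] in
/-- **Continuous mapping in probability at a point** (normed groups): `Xₙ → θ` in probability
and `φ : E → G` continuous at `θ` ⇒ `φ(Xₙ) → φ(θ)` in probability. [ours] -/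
theorem tendstoInMeasure_comp_continuousAt_normed {G : Type*} [NormedAddCommGroup G]
    {X : ℕ → Ω → E} {θ : E} (h : TendstoInMeasure P X atTop (fun _ => θ)) {φ : E → G}
    (hφ : ContinuousAt φ θ) :
    TendstoInMeasure P (fun n ω => φ (X n ω)) atTop (fun _ => φ θ) := by
  rw [tendstoInMeasure_iff_norm] at h ⊢
  intro ε hε
  obtain ⟨δ, hδ, hδε⟩ := Metric.continuousAt_iff.1 hφ ε hε
  refine tendsto_of_tendsto_of_tendsto_of_le_of_le' tendsto_const_nhds (h δ hδ)
    (Eventually.of_forall fun n => zero_le) (Eventually.of_forall fun n => ?_)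
  refine measure_mono fun ω hω => ?_
  simp only [Set.mem_setOf_eq] at hω ⊢
  by_contra hlt
  have hclose : dist (X n ω) θ < δ := by
    rw [dist_eq_norm]
    exact not_le.1 hlt
  have h' := hδε hclose
  rw [dist_eq_norm] at h'
  exact absurd hω (not_le.2 h')

variable [NormedSpace ℝ E] [SecondCountableTopology E]

/-- **A `√n`-type limit law pins the centring** (normed spaces): `aₙ • (Xₙ − θ) ⇒ Z` with
`aₙ → +∞` ⇒ `Xₙ → θ` in probability. [ours] (`‖Xₙ − θ‖ = aₙ⁻¹‖aₙ•(Xₙ − θ)‖` eventually;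
Slutsky with the deterministic `aₙ⁻¹ → 0`; `Scoring/DeltaMethod`'s real lemma) -/
theorem tendstoInMeasure_of_tendstoInDistribution_smul {X : ℕ → Ω → E} {θ : E} {a : ℕ → ℝ}
    (ha : Tendsto a atTop atTop) {Z : Ω' → E}
    (h : TendstoInDistribution (fun n ω => a n • (X n ω - θ)) atTop Z (fun _ => P) P') :
    TendstoInMeasure P X atTop (fun _ => θ) := by
  have hinv : TendstoInMeasure P (fun (n : ℕ) (_ : Ω) => (a n)⁻¹) atTop (fun _ => (0 : ℝ)) :=
    tendstoInMeasure_of_tendsto_ae (fun n => aestronglyMeasurable_const)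
      (Eventually.of_forall fun _ => ha.inv_tendsto_atTop)
  have hsl := h.continuous_comp_prodMk_of_tendstoInMeasure_const
    (g := fun z : E × ℝ => z.2 * ‖z.1‖) (by fun_prop) hinv (fun n => aemeasurable_const)
  have hconst : TendstoInDistribution (fun n ω => (a n)⁻¹ * ‖a n • (X n ω - θ)‖) atTop
      (fun _ : Ω' => (0 : ℝ)) (fun _ => P) P' :=
    hsl.congr (fun n => Eventually.of_forall fun ω => rfl)
      (Eventually.of_forall fun ω' => by simp)
  have hP := tendstoInMeasure_of_tendstoInDistribution_const hconst
  -- `‖Xₙ − θ‖ = aₙ⁻¹‖aₙ•(Xₙ − θ)‖` once `aₙ > 0`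
  rw [tendstoInMeasure_iff_norm] at hP ⊢
  intro ε hε
  refine (hP ε hε).congr' ?_
  filter_upwards [ha.eventually_gt_atTop 0] with n hn
  congr 1
  ext ω
  simp only [Set.mem_setOf_eq, sub_zero, norm_smul, Real.norm_eq_abs, abs_of_pos hn, ← mul_assoc,
    inv_mul_cancel₀ hn.ne', one_mul, abs_of_nonneg (norm_nonneg _)]

end Tools

/-! ## §2 The Fréchet remainder -/

section Remainder

variable {E : Type*} [NormedAddCommGroup E] [NormedSpace ℝ E]
variable {F : Type*} [NormedAddCommGroup F] [NormedSpace ℝ F]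

/-- The remainder ratio `ε(x) = ‖x − θ‖⁻¹·‖g x − g θ − L(x − θ)‖` of a map with Fréchet
derivative `L` at `θ` tends to `0 = ε(θ)` as `x → θ`, i.e. `ε` is continuous at `θ`. [ours]
(Mathlib's `hasFDerivAt_iff_tendsto`) -/
theorem tendsto_fderivRemainderRatio {g : E → F} {L : E →L[ℝ] F} {θ : E}
    (hg : HasFDerivAt g L θ) :
    ContinuousAt (fun x => ‖x - θ‖⁻¹ * ‖g x - g θ - L (x - θ)‖) θ := by
  have h := hasFDerivAt_iff_tendsto.1 hg
  have h0 : ‖θ - θ‖⁻¹ * ‖g θ - g θ - L (θ - θ)‖ = 0 := by simp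
  rw [ContinuousAt, h0]
  exact h

/-- The exact identity `‖a • (g x − g θ − L(x − θ))‖ = ε(x)·‖a • (x − θ)‖`. [ours] -/
theorem norm_smul_fderivRemainder_eq (g : E → F) (L : E →L[ℝ] F) (θ x : E) (a : ℝ) :
    ‖a • (g x - g θ - L (x - θ))‖
      = ‖x - θ‖⁻¹ * ‖g x - g θ - L (x - θ)‖ * ‖a • (x - θ)‖ := by
  by_cases hx : x = θ
  · subst hx
    simp
  · have hne : ‖x - θ‖ ≠ 0 := norm_ne_zero_iff.2 (sub_ne_zero.2 hx)
    rw [norm_smul, norm_smul]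
    field_simp

end Remainder

/-! ## §3 The multivariate delta method -/

section DeltaMethod

variable {Ω : Type*} [MeasurableSpace Ω] {P : Measure Ω} [IsProbabilityMeasure P]
variable {Ω' : Type*} [MeasurableSpace Ω'] {P' : Measure Ω'} [IsProbabilityMeasure P']
variable {E : Type*} [NormedAddCommGroup E] [NormedSpace ℝ E] [MeasurableSpace E] [BorelSpace E]
  [SecondCountableTopology E]
variable {F : Type*} [NormedAddCommGroup F] [NormedSpace ℝ F] [MeasurableSpace F] [BorelSpace F]
  [SecondCountableTopology F]

/-- **THE MULTIVARIATE DELTA METHOD.**  Statistics `Xₙ : Ω → E` (a.e.-measurable) in a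
second-countable real normed space, a centring `θ`, rates `aₙ → +∞` with `aₙ • (Xₙ − θ) ⇒ Z`;
`g : E → F` measurable into a second-countable real normed space with Fréchet derivative
`L : E →L[ℝ] F` at `θ`.  Then `aₙ • (g(Xₙ) − g(θ)) ⇒ L Z` in distribution. [ours] (our
formalisation of a classical theorem: `aₙ•(g Xₙ − g θ) = L(aₙ•(Xₙ − θ)) + Rₙ`,
`‖Rₙ‖ = ε(Xₙ)‖aₙ•(Xₙ − θ)‖ → 0` in probability by Slutsky; continuous mapping for `L`) -/
theorem tendstoInDistribution_deltaMethod_fderiv {X : ℕ → Ω → E} {θ : E} {a : ℕ → ℝ}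
    (ha : Tendsto a atTop atTop) {Z : Ω' → E}
    (h : TendstoInDistribution (fun n ω => a n • (X n ω - θ)) atTop Z (fun _ => P) P')
    (hXm : ∀ n, AEMeasurable (X n) P) {g : E → F} {L : E →L[ℝ] F} (hg : HasFDerivAt g L θ)
    (hgm : Measurable g) :
    TendstoInDistribution (fun n ω => a n • (g (X n ω) - g θ)) atTop (fun ω' => L (Z ω'))
      (fun _ => P) P' := by
  -- the remainder ratio `ε` and its measurability
  have hεm : Measurable fun x : E => ‖x - θ‖⁻¹ * ‖g x - g θ - L (x - θ)‖ :=
    (measurable_id.sub_const θ).norm.inv.mul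
      (((hgm.sub_const _).sub (L.continuous.measurable.comp (measurable_id.sub_const θ))).norm)
  -- `ε(Xₙ) → 0` in probability
  have hX := tendstoInMeasure_of_tendstoInDistribution_smul ha h
  have hε := tendstoInMeasure_comp_continuousAt_normed hX (tendsto_fderivRemainderRatio hg)
  have hε0 : ‖θ - θ‖⁻¹ * ‖g θ - g θ - L (θ - θ)‖ = 0 := by simp
  rw [hε0] at hε
  -- Slutsky: `ε(Xₙ)·‖aₙ•(Xₙ − θ)‖ ⇒ 0`, hence `→ 0` in probability
  have hsl := h.continuous_comp_prodMk_of_tendstoInMeasure_const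
    (g := fun z : E × ℝ => z.2 * ‖z.1‖) (by fun_prop) hε
    (fun n => hεm.comp_aemeasurable (hXm n))
  have hconst : TendstoInDistribution
      (fun n ω => ‖X n ω - θ‖⁻¹ * ‖g (X n ω) - g θ - L (X n ω - θ)‖ * ‖a n • (X n ω - θ)‖)
      atTop (fun _ : Ω' => (0 : ℝ)) (fun _ => P) P' :=
    hsl.congr (fun n => Eventually.of_forall fun ω => rfl)
      (Eventually.of_forall fun ω' => by simp)
  have hR := tendstoInMeasure_of_tendstoInDistribution_const hconst
  -- the remainder `Rₙ = aₙ • (g Xₙ − g θ − L(Xₙ − θ)) → 0` in probability (in `F`)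
  have hRF : TendstoInMeasure P (fun n ω => a n • (g (X n ω) - g θ - L (X n ω - θ))) atTop 0 := by
    rw [tendstoInMeasure_iff_norm] at hR ⊢
    intro δ hδ
    refine (hR δ hδ).congr' (Eventually.of_forall fun n => ?_)
    congr 1
    ext ω
    simp only [Set.mem_setOf_eq, sub_zero, Pi.zero_apply, norm_smul_fderivRemainder_eq,
      Real.norm_eq_abs, abs_of_nonneg (mul_nonneg (mul_nonneg (inv_nonneg.2 (norm_nonneg _))
        (norm_nonneg _)) (norm_nonneg _))]
  -- the linear part `L(aₙ•(Xₙ − θ)) ⇒ L Z`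
  have hL : TendstoInDistribution (fun n ω => L (a n • (X n ω - θ))) atTop (fun ω' => L (Z ω'))
      (fun _ => P) P' :=
    h.continuous_comp L.continuous
  -- assemble: `aₙ•(g Xₙ − g θ) = L(aₙ•(Xₙ − θ)) + Rₙ`
  have hYm : ∀ n, AEMeasurable (fun ω => a n • (g (X n ω) - g θ)) P := fun n =>
    ((hgm.comp_aemeasurable (hXm n)).sub_const _).const_smul _
  refine tendstoInDistribution_of_tendstoInMeasure_sub _ _ hL ?_ hYm
  have e : ((fun n ω => a n • (g (X n ω) - g θ)) - fun n ω => L (a n • (X n ω - θ)))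
      = fun n ω => a n • (g (X n ω) - g θ - L (X n ω - θ)) := by
    funext n ω
    simp only [Pi.sub_apply]
    rw [smul_sub (a n) (g (X n ω) - g θ) (L (X n ω - θ)), ContinuousLinearMap.map_smul]
  rw [e]
  exact hRF

end DeltaMethod

end Summit.Ventures.LatticeQCDFlow.Scoring.CardConsistency

end
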